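import Summits.ValiantsHypothesis.ValiantsHypothesis.Theses.ShallowShadows
import Summits.ValiantsHypothesis.ValiantsHypothesis.Theorems.ShadowFormulaTransfer.Negative.FalseOverCharTwo
import Summits.ValiantsHypothesis.ValiantsHypothesis.Theorems.ShallowShadowsShadowFormulaTransferWindow
import Literature.Computability.AlgebraicComplexity.DepthThreeChasmCircuits
import HarnessLib

/-!
# Crux `ShallowShadows.ShadowFormulaTransfer` (stmt-ValiantsHypothesis-17124), line `Sketch` —
# the registered stub `stub_betFarSide` (the far side of the line's bet)

The line's bet `Depth3Shadow` says: there are `κ < 2` and `K` such that every `0/1` sum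
`g = Σ_{τ<T} c_τ Π_{π<D} ℓ_{τπ}` of `T` products of `D` affine forms over `ℂ` in `N` variables
casts a monotone Boolean shadow `B g : a ↦ [∃ m ∈ supp g, supp m ⊆ {i | a i}]` of monotone
formula size `L` with `log₂ (L + 1) ≤ (log₂ (T+2))^κ (log₂ (N+2))^K + K log₂ (D+2) + K`.

This file CALIBRATES THE STRENGTH of the bet: together with Raz–Wigderson
(`RazWigdersonMatching`: `2^{c m} ≤ L_mon-formula(PM_m)` for `m ≥ m₀`) it forces every `ΣΠΣ`
representation `Σ_τ c_τ Π_π ℓ_{τπ} = per_m` over `ℂ` with `D ≤ 2^{⌊√m⌋}` affine factors per term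
to have top fan-in `T ≥ 2^{√m}` for all large `m` — exponential depth-three lower bounds for the
permanent over `ℂ` (only polynomial ones are in print), so the bet is a genuinely strong
statement.

Proof. Instantiate the bet at `ι = Fin m × Fin m` (`N = m²`) and the given representation: the
coefficients of `per_m` are `0/1` (`coeff_perPoly_eq_zero_or_one`) and its shadow is `PM_m`
(`shadow_perPoly_iff`), so with `X := log₂ (T+2) ≥ 1`, `μ := max κ 1 ∈ [1, 2)`:
`c m ≤ log₂ L ≤ log₂ (L+1) ≤ X^κ (log₂ (m²+2))^K + K log₂ (D+2) + K
  ≤ X^μ (log₂ (m²+2))^K + K (√m + 2) + K`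
(`log₂ (D+2) ≤ ⌊√m⌋ + 2` from `D + 2 ≤ 2^{⌊√m⌋+2}`, `window_logb_le_of_le_two_pow`). The analytic heart
(`farSide_eventually_lt`): `(√x + 2)^μ (log₂ (x²+2))^K + K (√x+2) + K < c x` eventually, because
`(√x+2)^μ ≤ 4 x^{μ/2}`, `log₂ (x²+2) ≤ 6 log x` and `(log x)^K = o(x^{1-μ/2})`
(`isLittleO_log_rpow_rpow_atTop`, `1 - μ/2 > 0`). Comparing, `(√m+2)^μ < X^μ`, so `√m + 2 < X`,
i.e. `4 · 2^{√m} = 2^{√m+2} < 2^X = T + 2`, whence `2^{√m} ≤ T`.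

## References

* [RazWigderson1992] R. Raz, A. Wigderson, *Monotone circuits for matching require linear
  depth*, J. ACM 39 (1992) 736–744 (the far side, entering only as the hypothesis
  `RazWigdersonMatching`).
* [Jukna2012] S. Jukna, *Boolean Function Complexity* (2012), §9.11 (`PM_m`), §7 (monotone depth).
* [GuptaKamathKayalSaptharishi2016] A. Gupta, P. Kamath, N. Kayal, R. Saptharishi, *Arithmetic
  circuits: a chasm at depth 3*, SIAM J. Comput. 45 (2016), Thm 1.1 (the `ΣΠΣ` form).
-/

-- Sub = Summit single-conjunct layout: the duplicated namespace component is mandated by the tree.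
set_option linter.dupNamespace false

noncomputable section

namespace Summit.ValiantsHypothesis.ValiantsHypothesis.Theorems.ShallowShadowsShadowFormulaTransfer

open Summit.ValiantsHypothesis.ValiantsHypothesis.Theses.ShallowShadows
open Literature.Computability.AlgebraicComplexity Literature.Computability.Complexity
open Literature.Computability.AlgebraicComplexity.DepthThreeChasm
open Literature.Barriers.PneNP MvPolynomial
open Filter

/-! ### Real-analysis helpers -/

-- `window_logb_le_of_le_two_pow` (`T + 2 ≤ 2^E ⟹ log₂ (T+2) ≤ E`) is reused from the landed
-- window bookkeeping `Theorems/ShallowShadowsShadowFormulaTransferWindow.lean`.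

/-- `1 ≤ log₂ (T + 2)`. [folklore] -/
theorem farSide_one_le_logb (T : ℕ) : 1 ≤ Real.logb 2 ((T : ℝ) + 2) := by
  rw [← Real.logb_self_eq_one (b := (2 : ℝ)) one_lt_two]
  exact Real.logb_le_logb_of_le one_lt_two two_pos
    (by linarith [(Nat.cast_nonneg T : (0 : ℝ) ≤ T)])

/-- `log₂ (x² + 2) ≤ 6 log x` for `x ≥ 4` (`x² + 2 ≤ x³`, `log 2 > 1/2`). [folklore] -/
theorem farSide_logb_sq_add_two_le {x : ℝ} (hx : 4 ≤ x) :
    Real.logb 2 (x * x + 2) ≤ 6 * Real.log x := by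
  have hx0 : 0 < x := by linarith
  have hcube : x * x + 2 ≤ x ^ 3 := by nlinarith
  have hlog3 : Real.log (x * x + 2) ≤ 3 * Real.log x := by
    calc Real.log (x * x + 2) ≤ Real.log (x ^ 3) := Real.log_le_log (by positivity) hcube
      _ = 3 * Real.log x := by rw [Real.log_pow]; norm_num
  have hlog2 : (1 : ℝ) / 2 < Real.log 2 := by
    have := Real.log_two_gt_d9
    norm_num at this ⊢
    linarith
  have hlx : 0 ≤ Real.log x := Real.log_nonneg (by linarith)
  rw [Real.logb, div_le_iff₀ (Real.log_pos one_lt_two)]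
  nlinarith [mul_nonneg hlx (by linarith : (0 : ℝ) ≤ 2 * Real.log 2 - 1)]

/-- The analytic heart: for `1 ≤ μ < 2`, `K : ℕ`, `c₀ > 0`, eventually in `x`,
`(√x + 2)^μ (log₂ (x² + 2))^K + K (√x + 2) + K < c₀ x` — everything on the left is
`O(x^{μ/2} (log x)^K)` and `(log x)^K = o(x^{1 - μ/2})`. [folklore] -/
theorem farSide_eventually_lt {μ : ℝ} (hμ1 : 1 ≤ μ) (hμ2 : μ < 2) (K : ℕ) {c₀ : ℝ}
    (hc₀ : 0 < c₀) :
    ∀ᶠ x : ℝ in atTop, (Real.sqrt x + 2) ^ μ * Real.logb 2 (x * x + 2) ^ K +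
      K * (Real.sqrt x + 2) + K < c₀ * x := by
  have hs : 0 < 1 - μ / 2 := by linarith
  have hlo := isLittleO_log_rpow_rpow_atTop (K : ℝ) hs
  set A : ℝ := 4 * 6 ^ K + 3 * K with hA
  have hApos : 0 < A := by positivity
  have hA0 : A ≠ 0 := hApos.ne'
  have hε : 0 < c₀ / (2 * A) := by positivity
  filter_upwards [hlo.def hε, eventually_ge_atTop (4 : ℝ)] with x hx hx4
  have hx0 : 0 < x := by linarith
  have hx1 : 1 ≤ x := by linarith
  -- the square root
  set r := Real.sqrt x with hr
  have hr0 : 0 ≤ r := Real.sqrt_nonneg x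
  have hrr : r * r = x := Real.mul_self_sqrt hx0.le
  have hr2 : 2 ≤ r := by nlinarith
  -- the two powers of `x`
  set P := x ^ (μ / 2) with hP
  set Q := x ^ (1 - μ / 2) with hQ
  have hP0 : 0 < P := Real.rpow_pos_of_pos hx0 _
  have hQ0 : 0 < Q := Real.rpow_pos_of_pos hx0 _
  have hPQ : P * Q = x := by
    rw [hP, hQ, ← Real.rpow_add hx0, show μ / 2 + (1 - μ / 2) = (1 : ℝ) by ring, Real.rpow_one]
  have hrP : r ≤ P := by
    rw [hr, Real.sqrt_eq_rpow, hP]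
    exact Real.rpow_le_rpow_of_exponent_le hx1 (by linarith)
  -- `(r + 2)^μ ≤ 4 P`
  have h2μ : (2 : ℝ) ^ μ ≤ 4 := by
    calc (2 : ℝ) ^ μ ≤ (2 : ℝ) ^ (2 : ℝ) := Real.rpow_le_rpow_of_exponent_le one_le_two hμ2.le
      _ = 4 := by rw [Real.rpow_two]; norm_num
  have hrμ : r ^ μ = P := by
    rw [hr, Real.sqrt_eq_rpow, ← Real.rpow_mul hx0.le, hP]
    congr 1
    ring
  have hterm1 : (r + 2) ^ μ ≤ 4 * P := by
    calc (r + 2) ^ μ ≤ (2 * r) ^ μ :=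
          Real.rpow_le_rpow (by linarith) (by linarith) (by linarith)
      _ = 2 ^ μ * r ^ μ := Real.mul_rpow zero_le_two hr0
      _ ≤ 4 * P := by rw [hrμ]; exact mul_le_mul_of_nonneg_right h2μ hP0.le
  -- the logarithms
  have hℓ1 : 1 ≤ Real.log x := by
    rw [Real.le_log_iff_exp_le hx0]
    have := Real.exp_one_lt_d9
    norm_num at this
    linarith
  have hℓ0 : 0 ≤ Real.log x := by linarith
  have hLK1 : 1 ≤ Real.log x ^ K := one_le_pow₀ hℓ1
  have hY0 : 0 ≤ Real.logb 2 (x * x + 2) := Real.logb_nonneg one_lt_two (by nlinarith)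
  have hY6 : Real.logb 2 (x * x + 2) ≤ 6 * Real.log x := farSide_logb_sq_add_two_le hx4
  have hYK : Real.logb 2 (x * x + 2) ^ K ≤ 6 ^ K * Real.log x ^ K := by
    calc _ ≤ (6 * Real.log x) ^ K := pow_le_pow_left₀ hY0 hY6 K
      _ = 6 ^ K * Real.log x ^ K := mul_pow _ _ _
  -- the little-o estimate at `x`
  have hlo' : Real.log x ^ K ≤ c₀ / (2 * A) * Q := by
    have := hx
    rw [Real.norm_of_nonneg (Real.rpow_nonneg hℓ0 _), Real.norm_of_nonneg hQ0.le,
      Real.rpow_natCast] at this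
    exact this
  -- assemble
  have hsum1 : (r + 2) ^ μ * Real.logb 2 (x * x + 2) ^ K ≤ 4 * 6 ^ K * (P * Real.log x ^ K) := by
    calc (r + 2) ^ μ * Real.logb 2 (x * x + 2) ^ K ≤ (4 * P) * (6 ^ K * Real.log x ^ K) :=
          mul_le_mul hterm1 hYK (pow_nonneg hY0 K) (by positivity)
      _ = 4 * 6 ^ K * (P * Real.log x ^ K) := by ring
  have hsum2 : (K : ℝ) * (r + 2) + K ≤ 3 * K * (P * Real.log x ^ K) := by
    have hK0 : (0 : ℝ) ≤ K := Nat.cast_nonneg K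
    have h1 : (K : ℝ) * (r + 2) + K ≤ 3 * K * r := by
      nlinarith [mul_nonneg hK0 (by linarith : (0 : ℝ) ≤ r - 2)]
    have h2 : r ≤ P * Real.log x ^ K := by
      calc r ≤ P := hrP
        _ = P * 1 := (mul_one P).symm
        _ ≤ P * Real.log x ^ K := mul_le_mul_of_nonneg_left hLK1 hP0.le
    have h3 : 3 * (K : ℝ) * r ≤ 3 * K * (P * Real.log x ^ K) :=
      mul_le_mul_of_nonneg_left h2 (by positivity)
    linarith
  have hsum : (r + 2) ^ μ * Real.logb 2 (x * x + 2) ^ K + K * (r + 2) + K ≤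
      A * (P * Real.log x ^ K) := by
    rw [hA]
    linarith
  have hfin : A * (P * Real.log x ^ K) ≤ c₀ / 2 * x := by
    calc A * (P * Real.log x ^ K) ≤ A * (P * (c₀ / (2 * A) * Q)) :=
          mul_le_mul_of_nonneg_left (mul_le_mul_of_nonneg_left hlo' hP0.le) hApos.le
      _ = c₀ / 2 * (P * Q) := by field_simp
      _ = c₀ / 2 * x := by rw [hPQ]
  have hcx : c₀ / 2 * x < c₀ * x := by nlinarith
  linarith

/-- The real bookkeeping of the far side, for one `m` past the analytic threshold: from
`2^{c₀ m} ≤ L`, `D ≤ 2^{⌊√m⌋}` and the bet's inequality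
`log₂ (L+1) ≤ (log₂ (T+2))^κ (log₂ (m²+2))^K + K log₂ (D+2) + K` conclude `2^{√m} ≤ T`.
[folklore] -/
theorem farSide_core {κ : ℝ} (hκ : κ < 2) (K : ℕ) {c₀ : ℝ} (hc₀ : 0 < c₀) :
    ∃ m₁ : ℕ, ∀ m ≥ m₁, ∀ (T D L : ℕ), (2 : ℝ) ^ (c₀ * m) ≤ L → D ≤ 2 ^ Nat.sqrt m →
      Real.logb 2 ((L : ℝ) + 1) ≤
        Real.logb 2 ((T : ℝ) + 2) ^ κ * Real.logb 2 ((m : ℝ) * m + 2) ^ K +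
          K * Real.logb 2 ((D : ℝ) + 2) + K →
      (2 : ℝ) ^ Real.sqrt m ≤ T := by
  set μ : ℝ := max κ 1 with hμ
  have hμ1 : 1 ≤ μ := le_max_right _ _
  have hμ2 : μ < 2 := max_lt hκ (by norm_num)
  obtain ⟨N, hN⟩ := eventually_atTop.mp
    ((tendsto_natCast_atTop_atTop (R := ℝ)).eventually (farSide_eventually_lt hμ1 hμ2 K hc₀))
  refine ⟨N, fun m hm T D L hL hD hb => ?_⟩
  have hw := hN m hm
  -- notation
  set X := Real.logb 2 ((T : ℝ) + 2) with hX
  set Y := Real.logb 2 ((m : ℝ) * m + 2) with hY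
  set r := Real.sqrt (m : ℝ) with hr
  have hX1 : 1 ≤ X := farSide_one_le_logb T
  have hm0 : (0 : ℝ) ≤ m := Nat.cast_nonneg m
  have hY0 : 0 ≤ Y := Real.logb_nonneg one_lt_two (by nlinarith)
  have hYK0 : 0 ≤ Y ^ K := pow_nonneg hY0 K
  have hr0 : 0 ≤ r := Real.sqrt_nonneg _
  -- Raz–Wigderson side: `c₀ m ≤ log₂ L ≤ log₂ (L + 1)`
  have hLpos : (0 : ℝ) < L := lt_of_lt_of_le (Real.rpow_pos_of_pos two_pos _) hL
  have h1 : c₀ * m ≤ Real.logb 2 (L : ℝ) := (Real.le_logb_iff_rpow_le one_lt_two hLpos).2 hL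
  have h2 : Real.logb 2 (L : ℝ) ≤ Real.logb 2 ((L : ℝ) + 1) :=
    Real.logb_le_logb_of_le one_lt_two hLpos (by linarith)
  -- degree side: `log₂ (D + 2) ≤ ⌊√m⌋ + 2 ≤ √m + 2`
  have hD2 : D + 2 ≤ 2 ^ (Nat.sqrt m + 2) := by
    have h4 : 1 ≤ 2 ^ Nat.sqrt m := Nat.one_le_two_pow
    calc D + 2 ≤ 2 ^ Nat.sqrt m + 2 := by omega
      _ ≤ 2 ^ Nat.sqrt m * 4 := by omega
      _ = 2 ^ (Nat.sqrt m + 2) := by rw [pow_add]; norm_num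
  have h3 : Real.logb 2 ((D : ℝ) + 2) ≤ (Nat.sqrt m : ℝ) + 2 := by
    have := window_logb_le_of_le_two_pow hD2
    push_cast at this
    exact this
  have h4 : (Nat.sqrt m : ℝ) ≤ r := Real.nat_sqrt_le_real_sqrt
  have h5 : (K : ℝ) * Real.logb 2 ((D : ℝ) + 2) ≤ K * (r + 2) :=
    mul_le_mul_of_nonneg_left (by linarith) (Nat.cast_nonneg K)
  -- `κ ↦ μ`
  have h6 : X ^ κ * Y ^ K ≤ X ^ μ * Y ^ K :=
    mul_le_mul_of_nonneg_right (Real.rpow_le_rpow_of_exponent_le hX1 (le_max_left _ _)) hYK0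
  -- compare with the analytic window
  have h7 : (r + 2) ^ μ * Y ^ K < X ^ μ * Y ^ K := by linarith
  have h8 : (r + 2) ^ μ < X ^ μ := lt_of_mul_lt_mul_right h7 hYK0
  have h9 : r + 2 < X :=
    (Real.rpow_lt_rpow_iff (by linarith) (by linarith) (by linarith)).1 h8
  -- exponentiate
  have hT2pos : (0 : ℝ) < (T : ℝ) + 2 := by positivity
  have h10 : (2 : ℝ) ^ (r + 2) < (2 : ℝ) ^ X := (Real.rpow_lt_rpow_left_iff one_lt_two).2 h9
  have h11 : (2 : ℝ) ^ X = (T : ℝ) + 2 := Real.rpow_logb two_pos (by norm_num) hT2pos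
  have h12 : (2 : ℝ) ^ (r + 2) = 2 ^ r * 4 := by
    rw [Real.rpow_add two_pos, Real.rpow_two]
    norm_num
  have h13 : (1 : ℝ) ≤ 2 ^ r := by
    have := Real.rpow_le_rpow_of_exponent_le one_le_two hr0
    rwa [Real.rpow_zero] at this
  rw [h11, h12] at h10
  linarith

/-- Transport of the bet's inequality along a pointwise equality of (two spellings of) the
shadow. [folklore] -/
theorem farSide_transfer {ι : Type} {B₁ B₀ : (ι → Bool) → Bool} {R : ℝ}
    (hb : Real.logb 2 ((formulaSizeOver monotoneBasis B₁ : ℝ) + 1) ≤ R)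
    (h : ∀ a, B₁ a = B₀ a) :
    Real.logb 2 ((formulaSizeOver monotoneBasis B₀ : ℝ) + 1) ≤ R := by
  obtain rfl : B₁ = B₀ := funext h
  exact hb

/-! ### The registered stub -/

/-- **Stub `BetFarSide`** (line `Sketch` of crux `ShadowFormulaTransfer`; calibration of the
strength of the line's bet `Depth3Shadow`). The bet together with Raz–Wigderson forces every
`ΣΠΣ` representation `Σ_τ c_τ Π_π ℓ_{τπ} = per_m` over `ℂ` with `D ≤ 2^{⌊√m⌋}` affine factors per
term to have top fan-in `T ≥ 2^{√m}` for all large `m`: instantiate the bet at the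
representation (`per_m` has `0/1` coefficients and shadow `PM_m` on `N = m²` variables), feed in
`2^{c m} ≤ L(PM_m)`, and compare with the analytic window `farSide_eventually_lt`.
[folklore; RazWigderson1992 (far side, as the hypothesis `RazWigdersonMatching`)] -/
theorem stub_betFarSide :
    (∃ κ : ℝ, κ < 2 ∧ ∃ K : ℕ, ∀ (ι : Type) [Fintype ι] [DecidableEq ι] (T D : ℕ) (c : Fin T → ℂ)
      (ℓ : Fin T → Fin D → (ι → ℂ) × ℂ),
      (∀ m : ι →₀ ℕ, (∑ τ, c τ • ∏ π, affVal (ℓ τ π)).coeff m = 0 ∨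
        (∑ τ, c τ • ∏ π, affVal (ℓ τ π)).coeff m = 1) →
      Real.logb 2 ((formulaSizeOver monotoneBasis (fun a : ι → Bool =>
          decide (∃ m ∈ (∑ τ, c τ • ∏ π, affVal (ℓ τ π)).support, ∀ i ∈ m.support, a i = true)) : ℝ)
          + 1) ≤
        Real.logb 2 (T + 2) ^ κ * Real.logb 2 (Fintype.card ι + 2) ^ K + K * Real.logb 2 (D + 2) + K) →
    RazWigdersonMatching →
    ∃ m₀ : ℕ, ∀ m ≥ m₀, ∀ (T D : ℕ) (c : Fin T → ℂ) (ℓ : Fin T → Fin D → (Fin m × Fin m → ℂ) × ℂ),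
      (∑ τ, c τ • ∏ π, affVal (ℓ τ π)) = perPoly (Fin m) ℂ → D ≤ 2 ^ Nat.sqrt m →
        (2 : ℝ) ^ Real.sqrt m ≤ T := by
  rintro ⟨κ, hκ, K, hbet⟩ ⟨c₀, hc₀, M₀, hM₀⟩
  obtain ⟨m₁, hm₁⟩ := farSide_core hκ K hc₀
  refine ⟨max M₀ m₁, fun m hm T D c ℓ hrepr hD => ?_⟩
  have hmM : M₀ ≤ m := (le_max_left _ _).trans hm
  have hm1 : m₁ ≤ m := (le_max_right _ _).trans hm
  -- the bet at the representation of `per_m`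
  have hb := hbet (Fin m × Fin m) T D c ℓ (fun mo => by
    rw [hrepr]
    exact Summit.ValiantsHypothesis.ValiantsHypothesis.Theorems.ShadowFormulaTransfer.Negative.FalseOverCharTwo.coeff_perPoly_eq_zero_or_one ℂ mo)
  rw [hrepr] at hb
  -- its shadow is `PM_m` (any `Decidable` spelling)
  have hb' := farSide_transfer (B₀ := perfectMatchingFn m) hb (fun a => by
    unfold perfectMatchingFn
    exact decide_eq_decide.mpr
      (Summit.ValiantsHypothesis.ValiantsHypothesis.Theorems.ShadowFormulaTransfer.Negative.FalseOverCharTwo.shadow_perPoly_iff ℂ a))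
  have hcard : ((Fintype.card (Fin m × Fin m) : ℕ) : ℝ) = (m : ℝ) * m := by
    rw [Fintype.card_prod, Fintype.card_fin, Nat.cast_mul]
  rw [hcard] at hb'
  exact hm₁ m hm1 T D _ (hM₀ m hmM) hD hb'

end Summit.ValiantsHypothesis.ValiantsHypothesis.Theorems.ShallowShadowsShadowFormulaTransfer

end
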